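import Summits.BirchSwinnertonDyer.Rank1Residual.Additive.RamifiedTwistTamagawa
import Summits.BirchSwinnertonDyer.Rank1Residual.AdditivePotMult.QuadraticTwistRamifiedMultiplicative
import Summits.BirchSwinnertonDyer.Rank1Residual.AdditivePotMult.QuadraticTwistTamagawaGood
import Summits.BirchSwinnertonDyer.Rank1Residual.AdditivePotMult.QuadraticTwistRamifiedPotMult
import HarnessLib

/-!
# The ramified-twist Tamagawa valuations of row T-MIL-ODD at EVERY odd prime
# (row T-MIL-ODD, FILE A-odd; seat n1011-p01 GEN 6; dedup notes of n1011-lit GEN 10)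

HONEST FRAMING (cell `b2b-bsdres`, run/shared/lean/b2b/bsd-rank1-residual/, verbatim in every
file): the goal of the cell is to DELETE the COMBINATION-SHAPED residual classes of the
Birch–Swinnerton-Dyer formula for ALL analytic-rank `≤ 1` elliptic curves over `ℚ` — "full BSD
formula for every rank `≤ 1` curve in class `C`" assembled STRICTLY from published theorems — so
that the rank-`≤ 1` remainder becomes exactly the CONSTRUCTION-SHAPED classes, which are TYPED
(missing-input `Prop`s), NOT attempted. This is not "finishing BSD". Sub-classes X3♯(M) / X4(M)
(additive, potentially multiplicative prime; base-change-and-descend): a RESEARCH ROUTE; they stay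
CONSTRUCTION-SHAPED; nothing is booked by this file; no mark / label moved. THEOREMS ONLY: no
definition, no named fact, no `sorry`.

## What and why (row T-MIL-ODD, `cells/n1011/skel/T-MIL-ODD.md`; lead R5-69 (h))

Stage A of the row (files `QuadraticTwistRamifiedMultiplicative`, `QuadraticTwistTamagawaGood`,
`QuadraticTwistRamifiedPotMult`) proved the twist-side Tamagawa entries of the local identities
(L_ℓ)@p at a RAMIFIED prime `ℓ ∥ d` under the hypothesis `5 ≤ p` (`c ≤ 4 < p`). As n1011-lit
GEN 10 observed (LIT-INPUTS-P3 §63 (B), §65), the case `p = 3` is ALREADY a theorem of the tree by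
name: additive-p4's `Additive/RamifiedTwistKodairaSymbol.lean`
(`Additive.kodairaSymbolAt_twist_of_semistable`: Tate's algorithm Steps 6–7 run in the kernel give
type `Iₙ*` for ANY equation `W = C • V^{(D)}` of the ramified twist of a good or multiplicative
odd place) and `Additive/RamifiedTwistTamagawa.lean` (`Additive.tamagawaNumberAt_twist_of_semistable_mem`:
`c_v(W) ∈ {1, 2, 4}`), whose currency `tamagawaNumberAt` is `rfl`-equal to this row's
`localTamagawaNumber` of the base change to the completion (`tamagawaNumberAt_def`). This file
records the upgrades, for EVERY ODD prime `p`: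

* `localTamagawaNumber_quadraticTwist_mem_of_dvd_of_semistable` — `c_v(V^{(d)}) ∈ {1, 2, 4}`;
* `padicValNat_localTamagawaNumber_quadraticTwist_eq_zero_of_dvd_of_mult_of_odd` /
  `…_of_dvd_of_good_of_odd` — `v_p(c_v(V^{(d)})) = 0` (`V` multiplicative / good at `v`);
* `localTamagawaNumber_mem_of_mult_twist`, `padicValNat_localTamagawaNumber_eq_zero_of_mult_twist_of_odd`
  — at the potentially multiplicative ramified prime itself (`Cd • W^{(d)} = Wd` multiplicative at
  `v`, so `W = C • Wd^{(d)}` by stage A's `exists_variableChange_smul_eq_of_smul_quadraticTwist_eq`):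
  `c_v(W) ∈ {1, 2, 4}` and `v_p(c_v(W)) = 0`.

So the skeleton's `p = 3` binders "(M5) or `3 ∤ c_ℓ(Wd)`" (§3, A-2) and "(G1)" are DISCHARGED BY
NAME; what genuinely remains at `p = 3` in the row is (A3) (the IV/IV* flip at an additive place
`ℓ ≠ 3` of `W` inert in `K`: row T-MIL-B, n1011-p08) and (D1)@3 for `W` of arbitrary type. In
print: Silverman *ATAEC* IV.9.4 Steps 6–7 and Table 4.1 (`I₀*`: `c ∈ {1, 2, 4}`; `Iₙ*`: `c ∈ {2, 4}`);
Comalada, JNT 49 (1994) (twist tables). HONEST LIMITS: TOOL theorems; closes no class; discharges no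
fact by itself; the proofs are n1011-lit GEN 10's checked scratch (v2, sha16 9da8bff814a37cc9)
landed by the row's owner (one producer per theorem).
-/

noncomputable section

open scoped Classical NumberField

open WeierstrassCurve NumberField IsDedekindDomain Rat.HeightOneSpectrum
  Literature.NumberTheory.EllipticCurves
  Summit.BirchSwinnertonDyer.Rank1Residual.Additive

namespace Summit.BirchSwinnertonDyer.Rank1Residual.AdditivePotMult

/-! ## §1 The ramified twist of a good or multiplicative odd place, every odd `p` -/

section Semistable

variable (V : WeierstrassCurve ℚ) [V.IsElliptic] [V.IsGloballyMinimal] (v : HeightOneSpectrum (𝓞 ℚ))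

/-- **`c_v(V^{(d)}) ∈ {1, 2, 4}` at the ramified twist (`ℓ ∥ d`, `ℓ` odd) of a place of good or
multiplicative reduction** — additive-p4's `tamagawaNumberAt_twist_of_semistable_mem` (Kodaira
type `Iₙ*` by Tate's algorithm Steps 6–7 in the kernel) read in the `localTamagawaNumber` currency
of row T-MIL-ODD (`tamagawaNumberAt_def` is `rfl`; `C = 1`).
[cite: SilvermanATAEC1994, IV.9.4 Steps 6–7 and Table 4.1 (PDF pp. 365–366)] -/
theorem localTamagawaNumber_quadraticTwist_mem_of_dvd_of_semistable (hv2 : (primesEquiv v : ℕ) ≠ 2)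
    {d : ℤ} (h1 : ((primesEquiv v : ℕ) : ℤ) ∣ d) (h2 : ¬ ((primesEquiv v : ℕ) : ℤ) ^ 2 ∣ d)
    (hV : V.HasGoodReductionAt v ∨ V.HasMultiplicativeReductionAt v) :
    ((V.quadraticTwist (d : ℚ)).baseChange (v.adicCompletion ℚ)).localTamagawaNumber
        (v.adicCompletionIntegers ℚ) = 1 ∨
      ((V.quadraticTwist (d : ℚ)).baseChange (v.adicCompletion ℚ)).localTamagawaNumber
        (v.adicCompletionIntegers ℚ) = 2 ∨
      ((V.quadraticTwist (d : ℚ)).baseChange (v.adicCompletion ℚ)).localTamagawaNumber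
        (v.adicCompletionIntegers ℚ) = 4 := by
  have hd0 : d ≠ 0 := by rintro rfl; exact h2 (dvd_zero _)
  have hdq : (d : ℚ) ≠ 0 := by exact_mod_cast hd0
  haveI := V.isElliptic_quadraticTwist hdq
  have h := tamagawaNumberAt_twist_of_semistable_mem v V hv2 hd0 h1 h2 hV (1 : VariableChange ℚ)
    (one_smul _ _)
  simpa only [tamagawaNumberAt_def] using h

/-- **`v_p(c_v(V^{(d)})) = 0` for EVERY ODD `p` at the ramified twist of a multiplicative place**
(type `Iₙ*`, `c ∈ {2, 4}`; `∈ {1, 2, 4}` suffices): the `p = 3` upgrade of stage A's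
`padicValNat_localTamagawaNumber_quadraticTwist_eq_zero_of_dvd_of_mult_of_five_le`.
[cite: SilvermanATAEC1994, IV.9.4 Step 7 and Table 4.1 (PDF pp. 365–366)] -/
theorem padicValNat_localTamagawaNumber_quadraticTwist_eq_zero_of_dvd_of_mult_of_odd
    (hv2 : (primesEquiv v : ℕ) ≠ 2) {d : ℤ} (h1 : ((primesEquiv v : ℕ) : ℤ) ∣ d)
    (h2 : ¬ ((primesEquiv v : ℕ) : ℤ) ^ 2 ∣ d) (hmult : V.HasMultiplicativeReductionAt v)
    (p : ℕ) [hp : Fact p.Prime] (hp2 : p ≠ 2) :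
    padicValNat p (((V.quadraticTwist (d : ℚ)).baseChange (v.adicCompletion ℚ)).localTamagawaNumber
        (v.adicCompletionIntegers ℚ)) = 0 := by
  have hp2' : ¬ p ∣ 2 := fun h ↦ hp2 ((Nat.prime_dvd_prime_iff_eq hp.out Nat.prime_two).mp h)
  have hp4 : ¬ p ∣ 4 := fun h ↦
    hp2' (((Nat.Prime.dvd_mul hp.out).mp (show p ∣ 2 * 2 by norm_num; exact h)).elim id id)
  refine padicValNat.eq_zero_of_not_dvd fun hdvd => ?_
  rcases localTamagawaNumber_quadraticTwist_mem_of_dvd_of_semistable V v hv2 h1 h2 (Or.inr hmult)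
    with h | h | h <;> rw [h] at hdvd
  · exact hp.out.one_lt.ne' (Nat.dvd_one.mp hdvd)
  · exact hp2' hdvd
  · exact hp4 hdvd

/-- **`v_p(c_v(V^{(d)})) = 0` for EVERY ODD `p` at the ramified twist of a good place** (type
`I₀*`, `c ∈ {1, 2, 4}`): the `p = 3` upgrade of stage A's
`padicValNat_localTamagawaNumber_quadraticTwist_eq_zero_of_dvd_of_good_of_five_le`.
[cite: SilvermanATAEC1994, IV.9.4 Step 6 and Table 4.1 (PDF pp. 365–366)] -/
theorem padicValNat_localTamagawaNumber_quadraticTwist_eq_zero_of_dvd_of_good_of_odd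
    (hv2 : (primesEquiv v : ℕ) ≠ 2) {d : ℤ} (h1 : ((primesEquiv v : ℕ) : ℤ) ∣ d)
    (h2 : ¬ ((primesEquiv v : ℕ) : ℤ) ^ 2 ∣ d) (hgood : V.HasGoodReductionAt v)
    (p : ℕ) [hp : Fact p.Prime] (hp2 : p ≠ 2) :
    padicValNat p (((V.quadraticTwist (d : ℚ)).baseChange (v.adicCompletion ℚ)).localTamagawaNumber
        (v.adicCompletionIntegers ℚ)) = 0 := by
  have hp2' : ¬ p ∣ 2 := fun h ↦ hp2 ((Nat.prime_dvd_prime_iff_eq hp.out Nat.prime_two).mp h)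
  have hp4 : ¬ p ∣ 4 := fun h ↦
    hp2' (((Nat.Prime.dvd_mul hp.out).mp (show p ∣ 2 * 2 by norm_num; exact h)).elim id id)
  refine padicValNat.eq_zero_of_not_dvd fun hdvd => ?_
  rcases localTamagawaNumber_quadraticTwist_mem_of_dvd_of_semistable V v hv2 h1 h2 (Or.inl hgood)
    with h | h | h <;> rw [h] at hdvd
  · exact hp.out.one_lt.ne' (Nat.dvd_one.mp hdvd)
  · exact hp2' hdvd
  · exact hp4 hdvd

end Semistable

/-! ## §2 The potentially multiplicative ramified prime itself, every odd `p` -/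

section PotMult

variable (W Wd : WeierstrassCurve ℚ) [W.IsElliptic] [Wd.IsElliptic] [Wd.IsGloballyMinimal]
  (v : HeightOneSpectrum (𝓞 ℚ))

/-- **`c_v(W) ∈ {1, 2, 4}` at the potentially multiplicative ramified prime**: `W = C • Wd^{(d)}`
(stage A's `exists_variableChange_smul_eq_of_smul_quadraticTwist_eq`) is an equation of the
ramified twist of the multiplicative curve `Wd`, so additive-p4's
`tamagawaNumberAt_twist_of_semistable_mem` applies verbatim (type `Iₙ*`, `n ≥ 1`).
[cite: SilvermanATAEC1994, IV.9.4 Step 7 and Table 4.1 (PDF pp. 365–366)] -/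
theorem localTamagawaNumber_mem_of_mult_twist (hv2 : (primesEquiv v : ℕ) ≠ 2) {d : ℤ}
    (h1 : ((primesEquiv v : ℕ) : ℤ) ∣ d) (h2 : ¬ ((primesEquiv v : ℕ) : ℤ) ^ 2 ∣ d)
    {Cd : VariableChange ℚ} (hCd : Cd • W.quadraticTwist (d : ℚ) = Wd)
    (hmult : Wd.HasMultiplicativeReductionAt v) :
    (W.baseChange (v.adicCompletion ℚ)).localTamagawaNumber (v.adicCompletionIntegers ℚ) = 1 ∨
      (W.baseChange (v.adicCompletion ℚ)).localTamagawaNumber (v.adicCompletionIntegers ℚ) = 2 ∨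
      (W.baseChange (v.adicCompletion ℚ)).localTamagawaNumber (v.adicCompletionIntegers ℚ) = 4 := by
  have hd0 : d ≠ 0 := by rintro rfl; exact h2 (dvd_zero _)
  have hdq : (d : ℚ) ≠ 0 := by exact_mod_cast hd0
  obtain ⟨C, hC⟩ := exists_variableChange_smul_eq_of_smul_quadraticTwist_eq W Wd hdq hCd
  have h := tamagawaNumberAt_twist_of_semistable_mem v Wd hv2 hd0 h1 h2 (Or.inr hmult) C hC.symm
  simpa only [tamagawaNumberAt_def] using h

/-- **`v_p(c_v(W)) = 0` for EVERY ODD `p` at the potentially multiplicative ramified prime** — the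
`p = 3` upgrade of stage A's `padicValNat_localTamagawaNumber_eq_zero_of_mult_twist_of_five_le`;
at `v = p = 3` this is the X3♯(M)/X4(M)@3 rows' own additive prime.
[cite: SilvermanATAEC1994, IV.9.4 Step 7 and Table 4.1 (PDF pp. 365–366)] -/
theorem padicValNat_localTamagawaNumber_eq_zero_of_mult_twist_of_odd
    (hv2 : (primesEquiv v : ℕ) ≠ 2) {d : ℤ} (h1 : ((primesEquiv v : ℕ) : ℤ) ∣ d)
    (h2 : ¬ ((primesEquiv v : ℕ) : ℤ) ^ 2 ∣ d) {Cd : VariableChange ℚ}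
    (hCd : Cd • W.quadraticTwist (d : ℚ) = Wd) (hmult : Wd.HasMultiplicativeReductionAt v)
    (p : ℕ) [hp : Fact p.Prime] (hp2 : p ≠ 2) :
    padicValNat p ((W.baseChange (v.adicCompletion ℚ)).localTamagawaNumber
        (v.adicCompletionIntegers ℚ)) = 0 := by
  have hp2' : ¬ p ∣ 2 := fun h ↦ hp2 ((Nat.prime_dvd_prime_iff_eq hp.out Nat.prime_two).mp h)
  have hp4 : ¬ p ∣ 4 := fun h ↦
    hp2' (((Nat.Prime.dvd_mul hp.out).mp (show p ∣ 2 * 2 by norm_num; exact h)).elim id id)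
  refine padicValNat.eq_zero_of_not_dvd fun hdvd => ?_
  rcases localTamagawaNumber_mem_of_mult_twist W Wd v hv2 h1 h2 hCd hmult with h | h | h <;>
    rw [h] at hdvd
  · exact hp.out.one_lt.ne' (Nat.dvd_one.mp hdvd)
  · exact hp2' hdvd
  · exact hp4 hdvd

end PotMult

end Summit.BirchSwinnertonDyer.Rank1Residual.AdditivePotMult

end
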